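import Summits.ResolutionOfSingularities.ResolutionOfSingularities.Theorems.PurelyInseparableDim4SwapTransportWindowCoreSigma
import HarnessLib
import HarnessLib.Audit.Tags

/-!
# Purely inseparable four-folds — THE REGIME-FREE CORE FOR A REAL STEP OF ANY KIND, EVERY σ = (n, n) + 0 AND EVERY PRIME: a twin-slot step or
# a rotation is shadowed by a TRANSLATED virtual slot step, with the slot-unit relation to the real child, BEFORE any pinning (cell `res-dim4-pi`,
# K2(p) lane, class (iii) rows σ = (n, n) + 0, flagless branch; the `1 ↦ n` edition of C♯ `…SwapTransportWindowCoreAnyPrime` p726205 over C1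
# `…SwapTransportWindowCoreSigma` p722931 and G1 `step_cases_of_weights_sigma0`; seat res-dim4-typ-1 g6)

[OURS · counted 0 · cell `res-dim4-pi` · K2(p) lane (holder res-dim4-p-12 g5, e = 3 MAP «class (iii) (2,2)+0 / (3,3)+0 flagless ⇒ regime R»);
res-dim4-p-3 g6 l.7164 «the σ-edition … is typ-1's 1 ↦ n substitution».]  Nothing here proves K2(p) for any `p`, any TAIL(p, p−1, 3), FLAGLESS♯, `NoIsolatedTrap p p` or resolution
of singularities in dimension ≥ 4 / characteristic `p` — NOT proved.  AI kernel work, weaker than expert review.  Transport bookkeeping about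
OUR frame; kills nothing by itself.

The flagless branch of a twin-slot class needs the case analysis of I1 `virtual_step_any_sigma0` at the level of C1's regime-free cores
(`virtual_core_slot_sigma0` / `virtual_core_rotate_sigma0`), which return the TRANSLATED virtual child `step p univ ℓ b′ B` (`b′ λ = b′ μ = 0`)
together with its relation to the real child — and nothing about the frame.  This file is exactly that packaging, letter for letter the
twin-weight edition of `virtual_core_any_prime`:
**`virtual_core_any_sigma0`** — letters `λ μ | u f`, bijection `π`, relation `(A, B)` at precision `M`, real weights `n·e_{πλ} + n·e_{πμ}`,
orders `p + n`; one honest real step `A′ = step p univ jr b A` (`b jr = 0`) whose child is isolated (certificate `Nc`) of order `p + 1`,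
weights of degree `2n`, `x^{r′} ∣ F′`, polar-kernel rank `eG`; `B` of order `p + n` with `r = n·e_λ + n·e_μ ∣ F`; budget
`Nc + 2p + n + 1 ≤ M`.  THEN there are `ℓ ∈ {λ, μ}`, `π′` — given by the recursion formulas of W5a (`ℓ = if jr = πλ then λ else if jr = πμ then μ
else if b (πλ) ≠ 0 then λ else μ`, `π′ = if jr ∈ {πλ, πμ} then π else swap ℓ (π⁻¹ jr) ∘ π`) — and a translation `b′` with
`b′ λ = b′ μ = 0` such that `step p univ ℓ b′ B` is related to `A′` along `π′` at precision `M − p`, `A′.r = e_{π′λ} + e_{π′μ}`, and the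
translated virtual child has order `p + n`, weights `n·e_λ + n·e_μ ∣ F`, is isolated and has polar-kernel rank `eG` (G1's
`step_cases_of_weights_sigma0` names the case; C1's two cores do the work).
[cite: Hauser2010, §§F–G] [cite: CossartJannsenSaito2020, Thm. 3.14]
bears_on: LADDER-RESOLUTION:D157-DOOR2 (res-dim4-pi · K2(p) · power cones · class (iii) σ = (n,n)+0 flagless branch, core of any kind).  Supports
stmt-ResolutionOfSingularities-16155 (helper).
-/

set_option linter.dupNamespace false -- mandated namespace of this single-conjunct summit

noncomputable section

namespace Summit.ResolutionOfSingularities.ResolutionOfSingularities.Theorems.PIDim4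

namespace SwapTransport

open MvPolynomial Finset
open Literature.AlgebraicGeometry.Resolution
open Literature.AlgebraicGeometry.Resolution.CentreBlowup
open Literature.AlgebraicGeometry.Resolution.Hauser2010
open Literature.AlgebraicGeometry.Resolution.HauserPerlega2019

variable {K : Type} [Field K] [DecidableEq K]

/-- **THE REGIME-FREE CORE FOR A REAL STEP OF ANY KIND, every σ = (n, n) + 0, every prime** (module docstring): the translated virtual slot
step that shadows one honest real step, with its relation, before any pinning. [OURS] [cite: Hauser2010, §§F–G]
[cite: CossartJannsenSaito2020, Thm. 3.14] -/
theorem virtual_core_any_sigma0 (p : ℕ) [Fact p.Prime] [CharP K p] {n : ℕ} (hn : 0 < n) (hnp : n < p) {la mu u f : Fin 4}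
    (hlm : la ≠ mu) (hlu : la ≠ u) (hlf : la ≠ f) (hmu : mu ≠ u) (hmf : mu ≠ f) (huf : u ≠ f) {π : Equiv.Perm (Fin 4)} {A B : State K}
    {M Nc : ℕ}
    (hrel : ∃ (θ e : Fin 4 → MvPolynomial (Fin 4) K) (U E : MvPolynomial (Fin 4) K),
      θ (π la) = X la * e la ∧ θ (π mu) = X mu * e mu ∧ constantCoeff (e la) ≠ 0 ∧ constantCoeff (e mu) ≠ 0 ∧
      constantCoeff (θ (π u)) = 0 ∧ constantCoeff (θ (π f)) = 0 ∧
      coeff (Finsupp.single u 1) (θ (π u)) * coeff (Finsupp.single f 1) (θ (π f)) -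
        coeff (Finsupp.single f 1) (θ (π u)) * coeff (Finsupp.single u 1) (θ (π f)) ≠ 0 ∧
      constantCoeff U ≠ 0 ∧ E ∈ originIdeal K ^ M ∧ B.F = deletePthPowers p (U ^ p * aeval θ A.F) + E)
    (hrA : A.r = Finsupp.single (π la) n + Finsupp.single (π mu) n) (hoA : ordZero A.F = ((p + n : ℕ) : ℕ∞))
    (hoB : ordZero B.F = ((p + n : ℕ) : ℕ∞)) (hrB : B.r = Finsupp.single la n + Finsupp.single mu n)
    (hdivB : ∀ e ∈ B.F.support, B.r ≤ e)
    {jr : Fin 4} {b : Fin 4 → K} (hbj : b jr = 0) {A' : State K} (hstep : A' = CentreBlowup.step p Finset.univ jr b A)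
    (hisoA' : IsIsolated p A'.F) (hcert : originIdeal K ^ Nc ≤ singLocusIdeal p A'.F ⊔ originIdeal K ^ (Nc + 1))
    (hoA' : ordZero A'.F = ((p + n : ℕ) : ℕ∞)) {eG : ℕ} (he3A' : Module.finrank K (ResCone.resVertex A') = eG)
    (hdegA' : A'.r.degree = 2 * n) (hdivA' : ∀ e ∈ A'.F.support, A'.r ≤ e) (hM : Nc + 2 * p + n + 1 ≤ M) :
    ∃ (ℓ : Fin 4) (π' : Equiv.Perm (Fin 4)) (b' : Fin 4 → K), (ℓ = la ∨ ℓ = mu) ∧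
      (ℓ = if jr = π la then la else if jr = π mu then mu else if b (π la) ≠ 0 then la else mu) ∧
      (π' = if jr = π la ∨ jr = π mu then π else (Equiv.swap ℓ (π.symm jr)).trans π) ∧
      b' la = 0 ∧ b' mu = 0 ∧
      (∃ (θ' e' : Fin 4 → MvPolynomial (Fin 4) K) (U' E' : MvPolynomial (Fin 4) K),
        θ' (π' la) = X la * e' la ∧ θ' (π' mu) = X mu * e' mu ∧ constantCoeff (e' la) ≠ 0 ∧ constantCoeff (e' mu) ≠ 0 ∧
        constantCoeff (θ' (π' u)) = 0 ∧ constantCoeff (θ' (π' f)) = 0 ∧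
        coeff (Finsupp.single u 1) (θ' (π' u)) * coeff (Finsupp.single f 1) (θ' (π' f)) -
          coeff (Finsupp.single f 1) (θ' (π' u)) * coeff (Finsupp.single u 1) (θ' (π' f)) ≠ 0 ∧
        constantCoeff U' ≠ 0 ∧ E' ∈ originIdeal K ^ (M - p) ∧
        (CentreBlowup.step p Finset.univ ℓ b' B).F = deletePthPowers p (U' ^ p * aeval θ' A'.F) + E') ∧
      A'.r = Finsupp.single (π' la) n + Finsupp.single (π' mu) n ∧
      ordZero (CentreBlowup.step p Finset.univ ℓ b' B).F = ((p + n : ℕ) : ℕ∞) ∧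
      (CentreBlowup.step p Finset.univ ℓ b' B).r = Finsupp.single la n + Finsupp.single mu n ∧
      (∀ e ∈ (CentreBlowup.step p Finset.univ ℓ b' B).F.support, (CentreBlowup.step p Finset.univ ℓ b' B).r ≤ e) ∧
      IsIsolated p (CentreBlowup.step p Finset.univ ℓ b' B).F ∧
      Module.finrank K (ResCone.resVertex (CentreBlowup.step p Finset.univ ℓ b' B)) = eG := by
  obtain ⟨θ, e, U, E, hθa, hθa', hea, hea', hu0, hf0, hdet, hU, hE, hrelF⟩ := hrel
  have hπlm : π la ≠ π mu := fun h => hlm (π.injective h)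
  have hπlu : π la ≠ π u := fun h => hlu (π.injective h)
  have hπlf : π la ≠ π f := fun h => hlf (π.injective h)
  have hπmu : π mu ≠ π u := fun h => hmu (π.injective h)
  have hπmf : π mu ≠ π f := fun h => hmf (π.injective h)
  have hπuf : π u ≠ π f := fun h => huf (π.injective h)
  have hdeg' : (CentreBlowup.step p Finset.univ jr b A).r.degree = 2 * n := by rw [← hstep]; exact hdegA'
  -- the swapped-orientation copies of the inputs
  have hrAs : A.r = Finsupp.single (π mu) n + Finsupp.single (π la) n := by rw [hrA, add_comm]
  have hrBs : B.r = Finsupp.single mu n + Finsupp.single la n := by rw [hrB, add_comm]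
  rcases step_cases_of_weights_sigma0 p hn hπlm hπlu hπlf hπmu hπmf hπuf hrA hoA (jr := jr) (b := b) hdeg' with
    ⟨hjr, hbmu, -⟩ | ⟨hjr, hbla, -⟩ | ⟨hjr, hrot⟩
  · -- slot step in the chart of `π λ`
    subst hjr
    obtain ⟨-, hrA', b', θ', e', U', E', hb'l, hb'm, h1, h2, h3, h4, h5, h6, h7, h8, h9, h10, ho', hr', hdiv', hiso', he3'⟩ :=
      virtual_core_slot_sigma0 p hn hnp hlm hlu hlf hmu hmf huf hθa hθa' hea hea' hu0 hf0 hdet hU hE hrelF hoA hrA hbj hstep hisoA'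
        hcert hoA' he3A' hdegA' hdivA' hoB hrB hdivB hM
    exact ⟨la, π, b', Or.inl rfl, by rw [if_pos rfl], by rw [if_pos (Or.inl rfl)], hb'l, hb'm, ⟨θ', e', U', E', h1, h2, h3, h4,
      h5, h6, h7, h8, h9, h10⟩, hrA', ho', hr', hdiv', hiso', he3'⟩
  · -- slot step in the chart of `π μ`
    subst hjr
    obtain ⟨-, hrA', b', θ', e', U', E', hb'm, hb'l, h1, h2, h3, h4, h5, h6, h7, h8, h9, h10, ho', hr', hdiv', hiso', he3'⟩ :=
      virtual_core_slot_sigma0 p hn hnp hlm.symm hmu hmf hlu hlf huf hθa' hθa hea' hea hu0 hf0 hdet hU hE hrelF hoA hrAs hbj hstep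
        hisoA' hcert hoA' he3A' hdegA' hdivA' hoB hrBs hdivB hM
    exact ⟨mu, π, b', Or.inr rfl, by rw [if_neg hπlm.symm, if_pos rfl], by rw [if_pos (Or.inr rfl)], hb'l, hb'm, ⟨θ', e', U', E',
      h2, h1, h4, h3, h5, h6, h7, h8, h9, h10⟩, by rw [hrA', add_comm], ho', by rw [hr', add_comm], hdiv', hiso', he3'⟩
  · -- rotation through the free letter `jr = π g`
    have hjl : jr ≠ π la := by rcases hjr with rfl | rfl <;> [exact hπlu.symm; exact hπlf.symm]
    have hjm : jr ≠ π mu := by rcases hjr with rfl | rfl <;> [exact hπmu.symm; exact hπmf.symm]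
    -- the free letter `g` with `jr = π g`, and its partner
    obtain ⟨g, gt, hg, hjg⟩ : ∃ g gt : Fin 4, ((g = u ∧ gt = f) ∨ (g = f ∧ gt = u)) ∧ jr = π g := by
      rcases hjr with h | h
      · exact ⟨u, f, Or.inl ⟨rfl, rfl⟩, h⟩
      · exact ⟨f, u, Or.inr ⟨rfl, rfl⟩, h⟩
    subst hjg
    have hsymm : π.symm (π g) = g := π.symm_apply_apply g
    rcases hrot with ⟨hbla, hbmu, hr'⟩ | ⟨hbmu, hbla, hr'⟩
    · -- the slot `π λ` is translated away: virtual chart `λ`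
      have hrA'g : A'.r = Finsupp.single (π g) n + Finsupp.single (π mu) n := by rw [hstep, hr']
      obtain ⟨π', b', θ', e', U', E', hπ', -, -, -, -, hb'l, hb'm, h1, h2, h3, h4, h5, h6, h7, h8, h9, h10, ho', hr'', hdiv', hiso',
        he3'⟩ :=
        virtual_core_rotate_sigma0 p hn hnp hlm hlu hlf hmu hmf huf hg hθa hθa' hea hea' hu0 hf0 hdet hU hE hrelF hoA hbj hbla hbmu
          hstep hisoA' hcert hoA' he3A' hrA'g hdivA' hoB hrB hdivB hM
      have hπ'l : π' la = π g := by rw [hπ', Equiv.trans_apply, Equiv.swap_apply_left]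
      have hπ'm : π' mu = π mu := by
        have hmg : mu ≠ g := by rcases hg with ⟨rfl, -⟩ | ⟨rfl, -⟩ <;> [exact hmu; exact hmf]
        rw [hπ', Equiv.trans_apply, Equiv.swap_apply_of_ne_of_ne hlm.symm hmg]
      exact ⟨la, π', b', Or.inl rfl, by rw [if_neg hjl, if_neg hjm, if_pos hbla], by rw [if_neg (not_or.mpr ⟨hjl, hjm⟩), hsymm, hπ'],
        hb'l, hb'm, ⟨θ', e', U', E', h1, h2, h3, h4, h5, h6, h7, h8, h9, h10⟩, by rw [hrA'g, hπ'l, hπ'm], ho', hr'', hdiv', hiso',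
        he3'⟩
    · -- the slot `π μ` is translated away: virtual chart `μ`
      have hrA'g : A'.r = Finsupp.single (π g) n + Finsupp.single (π la) n := by rw [hstep, hr']
      obtain ⟨π', b', θ', e', U', E', hπ', -, -, -, -, hb'm, hb'l, h1, h2, h3, h4, h5, h6, h7, h8, h9, h10, ho', hr'', hdiv', hiso',
        he3'⟩ :=
        virtual_core_rotate_sigma0 p hn hnp hlm.symm hmu hmf hlu hlf huf hg hθa' hθa hea' hea hu0 hf0 hdet hU hE hrelF hoA hbj hbmu
          hbla hstep hisoA' hcert hoA' he3A' hrA'g hdivA' hoB hrBs hdivB hM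
      have hπ'm : π' mu = π g := by rw [hπ', Equiv.trans_apply, Equiv.swap_apply_left]
      have hπ'l : π' la = π la := by
        have hlg : la ≠ g := by rcases hg with ⟨rfl, -⟩ | ⟨rfl, -⟩ <;> [exact hlu; exact hlf]
        rw [hπ', Equiv.trans_apply, Equiv.swap_apply_of_ne_of_ne hlm hlg]
      have hbla0 : ¬ b (π la) ≠ 0 := not_not.mpr hbla
      exact ⟨mu, π', b', Or.inr rfl, by rw [if_neg hjl, if_neg hjm, if_neg hbla0],
        by rw [if_neg (not_or.mpr ⟨hjl, hjm⟩), hsymm, hπ'], hb'l, hb'm, ⟨θ', e', U', E', h2, h1, h4, h3, h5, h6, h7, h8, h9, h10⟩,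
        by rw [hrA'g, hπ'l, hπ'm, add_comm], ho', by rw [hr'', add_comm], hdiv', hiso', he3'⟩

end SwapTransport

end Summit.ResolutionOfSingularities.ResolutionOfSingularities.Theorems.PIDim4

end
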